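import Summits.Ventures.PercRepro.ProfileUnicyclicCircuit
import Summits.Ventures.PercRepro.ProfileMixedStep

/-!
# PercRepro — THE LOOP INSTANCE OF THE CIRCUIT-MARKED CONJECTURE IS THEOREM A (p10, gen 10; `proofs/P10-AVFULL.md`
§19(d))

For a LOOP `e` the unicyclic sets with circuit `{e}` and independent complement are exactly the sets `Y ∪ {e}` with
`Y` bi-independent in `M ∖ e` (`uniIndepSetsCirc_loop_eq`), so `U^{{e}}_k = P_{k−1}(M ∖ e)` and the instance `D = {e}`
of `UniCircLym` — `(n − k)·U^{{e}}_k ≤ k·U^{{e}}_{k+1}` for `2k + 1 ≤ n` — is the unimodality of the bi-independent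
density of `M ∖ e` (`P_j / C(n−1, j)` nondecreasing for `j + 1 ≤ (n−1)/2`), i.e. THEOREM A (Brändén–Huh) for `M ∖ e`.
This file proves it CONDITIONALLY on the named fact `BiIndepDensityLogConcave` (ProfileBiIndepDensity; never asserted):

* `rk_insert_loop` (adding a loop does not change the rank; `rk_le_card'` is the tree's);
* `biIndepDensity_mono_of_fact` — the named fact + the complement symmetry give the unimodality
  `(n − j)·P_j ≤ (j + 1)·P_{j+1}` for `2j + 2 ≤ n` (the argument of `profileIneqMinusQ_of_card_eq_succ`, isolated);
* `uniIndepSetsCirc_loop_eq`, `card_uniIndepSetsCirc_loop` (the transport `U^{{e}}_{k+1} = P_k(M ∖ e)`);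
* **`uniCircLym_loop`** — the conjecture at every loop, modulo the named fact.
-/

open scoped Matroid

namespace PercRepro.Cogirth

open Finset ThmH Skew Shadow Profile

variable {α : Type} [DecidableEq α] {M : Matroid α} [M.Finite] {e : α}

/-- A loop of `M` (`rk M {e} = 0`, `e ∈ E`) lies in every closure, so adding it does not change the rank. -/
theorem rk_insert_loop (he : e ∈ gr M) (hl : rk M {e} = 0) (Y : Finset α) (hY : Y ⊆ gr M) :
    rk M (insert e Y) = rk M Y := by
  have heE : e ∈ M.E := by rw [← coe_gr]; exact_mod_cast he
  have hYE : (Y : Set α) ⊆ M.E := by rw [← coe_gr]; exact_mod_cast hY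
  have hl' : M.eRk ({e} : Set α) = 0 := by
    have := congrArg (fun k : ℕ => (k : ℕ∞)) hl
    simp only [coe_rk, Finset.coe_singleton, Nat.cast_zero] at this
    exact this
  have hloop : M.IsLoop e := by
    rw [Matroid.isLoop_iff]
    have := (Matroid.eRk_eq_zero_iff (Set.singleton_subset_iff.2 heE)).1 hl'
    exact Set.singleton_subset_iff.1 this
  have hmem : e ∈ M.closure (Y : Set α) := hloop.mem_closure _
  have hcoe : ((insert e Y : Finset α) : Set α) = insert e (Y : Set α) := Finset.coe_insert e Y
  apply le_antisymm
  · have h1 : M.eRk ((insert e Y : Finset α) : Set α) ≤ M.eRk (M.closure (Y : Set α)) := by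
      apply M.eRk_mono
      rw [hcoe]
      exact Set.insert_subset hmem (M.subset_closure _ hYE)
    rw [Matroid.eRk_closure_eq, ← coe_rk, ← coe_rk] at h1
    exact_mod_cast h1
  · have h1 : M.eRk (Y : Set α) ≤ M.eRk ((insert e Y : Finset α) : Set α) := by
      apply M.eRk_mono
      rw [hcoe]
      exact Set.subset_insert _ _
    rw [← coe_rk, ← coe_rk] at h1
    exact_mod_cast h1

/-! ### The named fact gives the unimodality of the bi-independent density -/

/-- **Unimodality from the named fact**: `(n − j)·P_j ≤ (j + 1)·P_{j+1}` for `2j + 2 ≤ n` (the density `P_j / C(n,j)`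
is nondecreasing up to the middle; the argument of `profileIneqMinusQ_of_card_eq_succ`, isolated). -/
theorem biIndepDensity_mono_of_fact (hfact : BiIndepDensityLogConcave α) (N : Matroid α) [N.Finite] (j : ℕ)
    (hj : 2 * j + 2 ≤ (gr N).card) :
    ((gr N).card - j) * (biIndepSets N j).card ≤ (j + 1) * (biIndepSets N (j + 1)).card := by
  obtain ⟨hlc, hniz⟩ := hfact N
  generalize hN : (gr N).card = n at *
  set P : ℕ → ℕ := fun k => (biIndepSets N k).card with hP
  have hsymm : ∀ k, k ≤ n → P k = P (n - k) := by
    intro k hk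
    simp only [hP]
    rw [← hN]
    exact card_biIndepSets_symm N (by omega)
  let a : ℕ → ℚ := fun k => (P k : ℚ) / (n.choose k : ℚ)
  have ha : ∀ k, 0 ≤ a k := fun k => div_nonneg (Nat.cast_nonneg _) (Nat.cast_nonneg _)
  have hchoose_pos : ∀ k, k ≤ n → (0 : ℚ) < n.choose k := fun k hk => by exact_mod_cast Nat.choose_pos hk
  have halc : ∀ k, 1 ≤ k → k + 1 ≤ n → a (k - 1) * a (k + 1) ≤ a k * a k := by
    intro k hk1 hkn
    have h := hlc k hk1 hkn
    have c1 := hchoose_pos (k - 1) (by omega)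
    have c2 := hchoose_pos (k + 1) (by omega)
    have c3 := hchoose_pos k (by omega)
    simp only [a, hP]
    rw [div_mul_div_comm, div_mul_div_comm, div_le_div_iff₀ (by positivity) (by positivity)]
    have h' : ((biIndepSets N (k - 1)).card * (biIndepSets N (k + 1)).card *
        (n.choose k * n.choose k) : ℚ) ≤
        (biIndepSets N k).card * (biIndepSets N k).card * (n.choose (k - 1) * n.choose (k + 1)) := by
      exact_mod_cast h
    nlinarith [h']
  have haniz : ∀ i k j, i < k → k < j → j ≤ n → 0 < a i → 0 < a j → 0 < a k := by
    intro i k j hik hkj hjn hi hj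
    simp only [a, hP] at hi hj ⊢
    have ci := hchoose_pos i (by omega)
    have cj := hchoose_pos j (by omega)
    have ck := hchoose_pos k (by omega)
    rw [div_pos_iff_of_pos_right ci] at hi
    rw [div_pos_iff_of_pos_right cj] at hj
    rw [div_pos_iff_of_pos_right ck]
    exact_mod_cast hniz i k j hik hkj hjn (by exact_mod_cast hi) (by exact_mod_cast hj)
  -- the pairwise inequality with i = j + 1 and j' = n − j − 1 ≥ i:  a_j · a_{n−j} ≤ a_{j+1} · a_{n−j−1}
  have hpair := lc_pairwise (n := n) a ha halc haniz (j + 1) (by omega) (n - j - 1) (by omega) (by omega)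
  have e1 : j + 1 - 1 = j := by omega
  have e2 : n - j - 1 + 1 = n - j := by omega
  rw [e1, e2] at hpair
  have hs1 : a (n - j) = a j := by
    simp only [a]
    rw [hsymm j (by omega), Nat.choose_symm (by omega : j ≤ n)]
  have hs2 : a (n - j - 1) = a (j + 1) := by
    simp only [a]
    have : n - j - 1 = n - (j + 1) := by omega
    rw [this, hsymm (j + 1) (by omega), Nat.choose_symm (by omega : j + 1 ≤ n)]
  rw [hs1, hs2] at hpair
  -- a_j ≤ a_{j+1}
  have hmono : a j ≤ a (j + 1) := by nlinarith [hpair, ha j, ha (j + 1)]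
  have hnat : P j * n.choose (j + 1) ≤ P (j + 1) * n.choose j := by
    have c1 := hchoose_pos j (by omega)
    have c2 := hchoose_pos (j + 1) (by omega)
    simp only [a] at hmono
    rw [div_le_div_iff₀ c1 c2] at hmono
    exact_mod_cast hmono
  -- C(n, j+1) · (j+1) = C(n, j) · (n − j)
  have hid : n.choose (j + 1) * (j + 1) = n.choose j * (n - j) := by
    have := Nat.choose_succ_right_eq n j
    rw [this]
  show (n - j) * P j ≤ (j + 1) * P (j + 1)
  have hpos : 0 < n.choose j := Nat.choose_pos (by omega)
  refine Nat.le_of_mul_le_mul_left ?_ hpos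
  calc n.choose j * ((n - j) * P j) = (n.choose j * (n - j)) * P j := by ring
    _ = (n.choose (j + 1) * (j + 1)) * P j := by rw [hid]
    _ = (j + 1) * (P j * n.choose (j + 1)) := by ring
    _ ≤ (j + 1) * (P (j + 1) * n.choose j) := Nat.mul_le_mul_left _ hnat
    _ = n.choose j * ((j + 1) * P (j + 1)) := by ring

/-! ### The transport: unicyclic sets with a loop as circuit -/

/-- For a loop `e`, the unicyclic `(k+1)`-sets with circuit `{e}` and independent complement are the sets `insert e Y`
with `Y` bi-independent in `M ∖ e` of size `k`. -/
theorem uniIndepSetsCirc_loop_eq (he : e ∈ gr M) (hl : rk M {e} = 0) (k : ℕ) :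
    uniIndepSetsCirc M {e} (k + 1) =
      (biIndepSets (M ＼ ({e} : Set α)) k).image (fun Y => insert e Y) := by
  ext X
  rw [mem_uniIndepSetsCirc, mem_uniIndepSets, Finset.mem_image]
  constructor
  · rintro ⟨⟨hXg, hXk, _, hXc⟩, hcirc⟩
    have heC : e ∈ circ M X := by rw [hcirc]; exact Finset.mem_singleton_self e
    have heX : e ∈ X := circ_subset X heC
    rw [mem_circ] at heC
    refine ⟨X.erase e, ?_, Finset.insert_erase heX⟩
    rw [mem_biIndepSets, gr_delete']
    have hsub : X.erase e ⊆ (gr M).erase e := Finset.erase_subset_erase e hXg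
    have hcompl : (gr M).erase e \ X.erase e = gr M \ X := by
      ext x
      simp only [Finset.mem_sdiff, Finset.mem_erase]
      constructor
      · rintro ⟨⟨hxe, hxg⟩, hx⟩
        exact ⟨hxg, fun hxX => hx ⟨hxe, hxX⟩⟩
      · rintro ⟨hxg, hxX⟩
        exact ⟨⟨fun hxe => hxX (hxe ▸ heX), hxg⟩, fun h => hxX h.2⟩
    have hsubc : gr M \ X ⊆ (gr M).erase e := by
      intro x hx
      rw [Finset.mem_sdiff] at hx
      rw [Finset.mem_erase]
      exact ⟨fun hxe => hx.2 (hxe ▸ heX), hx.1⟩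
    refine ⟨hsub, ?_, ?_, ?_⟩
    · rw [Finset.card_erase_of_mem heX, hXk]; rfl
    · rw [rk_delete hsub]; exact heC.2
    · rw [hcompl, rk_delete hsubc]; exact hXc
  · rintro ⟨Y, hY, rfl⟩
    rw [mem_biIndepSets, gr_delete'] at hY
    obtain ⟨hYg, hYk, hYr, hYc⟩ := hY
    have heY : e ∉ Y := fun h => (Finset.mem_erase.1 (hYg h)).1 rfl
    have hYg' : Y ⊆ gr M := hYg.trans (Finset.erase_subset e _)
    have hcompl : (gr M).erase e \ Y = gr M \ insert e Y := by
      ext x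
      simp only [Finset.mem_sdiff, Finset.mem_erase, Finset.mem_insert]
      constructor
      · rintro ⟨⟨hxe, hxg⟩, hxY⟩
        exact ⟨hxg, fun h => h.elim hxe hxY⟩
      · rintro ⟨hxg, hx⟩
        exact ⟨⟨fun h => hx (Or.inl h), hxg⟩, fun h => hx (Or.inr h)⟩
    have hsubc : gr M \ insert e Y ⊆ (gr M).erase e := by
      intro x hx
      rw [Finset.mem_sdiff, Finset.mem_insert] at hx
      rw [Finset.mem_erase]
      exact ⟨fun h => hx.2 (Or.inl h), hx.1⟩
    have hrkY : rk M Y = Y.card := by rw [← rk_delete hYg]; exact hYr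
    have hrk : rk M (insert e Y) = Y.card := by rw [rk_insert_loop he hl Y hYg']; exact hrkY
    have hcard : (insert e Y).card = k + 1 := by rw [Finset.card_insert_of_notMem heY, hYk]
    refine ⟨⟨Finset.insert_subset he hYg', hcard, by rw [hrk, hcard, hYk], ?_⟩, ?_⟩
    · rw [← rk_delete hsubc, ← hcompl]; exact hYc
    · -- the circuit-carrier of `insert e Y` is `{e}`
      ext x
      rw [mem_circ, Finset.mem_singleton]
      constructor
      · rintro ⟨hx, hxr⟩
        by_contra hxe
        have hxY : x ∈ Y := (Finset.mem_insert.1 hx).resolve_left hxe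
        have h1 : (insert e Y).erase x = insert e (Y.erase x) := Finset.erase_insert_of_ne (Ne.symm hxe)
        have h2 : e ∉ Y.erase x := fun h => heY (Finset.mem_of_mem_erase h)
        rw [h1, rk_insert_loop he hl _ ((Finset.erase_subset x Y).trans hYg'),
          Finset.card_insert_of_notMem h2] at hxr
        have := rk_le_card' (M := M) (Y.erase x)
        omega
      · intro hx
        rw [hx]
        refine ⟨Finset.mem_insert_self e Y, ?_⟩
        rw [Finset.erase_insert heY]
        exact hrkY

/-- The transport of counts: `U^{{e}}_{k+1} = P_k(M ∖ e)` for a loop `e`. -/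
theorem card_uniIndepSetsCirc_loop (he : e ∈ gr M) (hl : rk M {e} = 0) (k : ℕ) :
    (uniIndepSetsCirc M {e} (k + 1)).card = (biIndepSets (M ＼ ({e} : Set α)) k).card := by
  rw [uniIndepSetsCirc_loop_eq he hl k]
  apply Finset.card_image_of_injOn
  intro Y₁ hY₁ Y₂ hY₂ h
  rw [Finset.mem_coe, mem_biIndepSets, gr_delete'] at hY₁ hY₂
  have h₁ : e ∉ Y₁ := fun hh => (Finset.mem_erase.1 (hY₁.1 hh)).1 rfl
  have h₂ : e ∉ Y₂ := fun hh => (Finset.mem_erase.1 (hY₂.1 hh)).1 rfl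
  have := congrArg (fun Z : Finset α => Z.erase e) h
  simpa only [Finset.erase_insert h₁, Finset.erase_insert h₂] using this

/-- There are no unicyclic `0`-sets. -/
theorem uniIndepSetsCirc_zero (D : Finset α) : uniIndepSetsCirc M D 0 = ∅ := by
  ext X
  simp only [mem_uniIndepSetsCirc, mem_uniIndepSets, Finset.notMem_empty, iff_false]
  rintro ⟨⟨_, hXk, hXr, _⟩, _⟩
  omega

/-- **THE LOOP INSTANCE OF `UniCircLym` IS THEOREM A**: for a loop `e`, modulo the named fact,
`(n − k)·U^{{e}}_k ≤ k·U^{{e}}_{k+1}` for `2k + 1 ≤ n`. -/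
theorem uniCircLym_loop (hfact : BiIndepDensityLogConcave α) (M : Matroid α) [M.Finite] {e : α}
    (he : e ∈ gr M) (hl : rk M {e} = 0) (k : ℕ) (hk : 2 * k + 1 ≤ (gr M).card) :
    ((gr M).card - k) * (uniIndepSetsCirc M {e} k).card ≤ k * (uniIndepSetsCirc M {e} (k + 1)).card := by
  rcases k with _ | j
  · rw [uniIndepSetsCirc_zero, Finset.card_empty]; simp
  · rw [card_uniIndepSetsCirc_loop he hl j, card_uniIndepSetsCirc_loop he hl (j + 1)]
    have hn : (gr (M ＼ ({e} : Set α))).card = (gr M).card - 1 := by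
      rw [gr_delete', Finset.card_erase_of_mem he]
    have h := biIndepDensity_mono_of_fact hfact (M ＼ ({e} : Set α)) j (by omega)
    rw [hn] at h
    have e1 : (gr M).card - 1 - j = (gr M).card - (j + 1) := by omega
    rw [e1] at h
    exact h

end PercRepro.Cogirth
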